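import Summits.AtomisticToContinuum.FouriersLaw.Theorems.VanishingNoiseTransferVanishingNoiseBoundNessWeightedDuhamel

/-!
# (E) The Gibbs measure at `T` is `O(δ)`-almost invariant under the transition kernels at
`(T+δ/2, T-δ/2)` (stub S2b `stub_nessFlipAsymmetryLipschitz`, line `fekete-usc-one-length`, brick 4)

`--supports stmt-AtomisticToContinuum-11976` helper file (crux `VanishingNoiseBound`, route
`VanishingNoiseTransfer`). Input (E) of the reduction `…NessLipschitzReduction.lean`:

* `pinnedChain_gibbsMeasure_almost_invariant` — for `pinnedChain ω₂ lam β γ` (`ω₂ > 0`,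
  `lam, β, γ ≥ 0`, `N ≥ 1`), `T > 0`, `0 < ϑ < 1/T` and `t > 0` there is `C ≥ 0` with
  `|∫ (P_t^{(T+δ/2,T-δ/2)} g) dμ_T - ∫ g dμ_T| ≤ C|δ|` for every `|δ| < 2T` with
  `ϑ < 1/max(T+δ/2,T-δ/2)` and every MEASURABLE `|g| ≤ e^{ϑH}` (`μ_T = gibbsMeasure N T`).

Proof: the weighted Duhamel bound (`pinnedChain_abs_integral_mul_transitionKernel_sub_le`) for the
truncated Gibbs weights `ρ_R = e^{-H/T}χ(H/R)`, whose stationary defect at `(T+δ/2, T-δ/2)` is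
`O(|δ| + 1/R)(1 + p_0² + p_{N-1}²)e^{-H/T}` (`revGenerator_truncGibbs_defect_le`: the Gibbs weight at
the MEAN temperature solves the stationary Fokker–Planck equation up to
`(γδ/2T²)(p_0² - p_{N-1}²)e^{-H/T}`), dominated convergence `R → ∞`, and normalisation by `Z`.
No fluctuation theorem, no density of the steady state, no hypoellipticity is used. No definitions.
-/

noncomputable section

namespace Summit.AtomisticToContinuum.FouriersLaw.Theorems.FixedLengthNoiseContinuity

open MeasureTheory ProbabilityTheory Filter Topology Set
open scoped NNReal ENNReal ContDiff
open Literature.MathematicalPhysics.KineticTheory.HeatConduction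
open Literature.MathematicalPhysics.KineticTheory Literature.Probability.Process OscillatorChain
open Summit.AtomisticToContinuum.FouriersLaw.Theorems.SubdiffusiveBondHeat
open Summit.AtomisticToContinuum.FouriersLaw.Theorems.NessUnique

variable {N : ℕ}

/-! ## §3 (E): the Gibbs measure at `T` is `O(δ)`-almost invariant under `P_t^{(T+δ/2, T-δ/2)}` -/

section AlmostInvariant

variable {ω₂ lam β γ : ℝ} (hω : 0 < ω₂) (hl : 0 ≤ lam) (hβ : 0 ≤ β) (hγ : 0 ≤ γ) (hN : 0 < N)
  {T : ℝ} (hT : 0 < T) {ϑ : ℝ} (hϑ : 0 < ϑ) (hϑT : ϑ < 1 / T)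
include hω hl hβ hγ hN hT hϑ hϑT

omit hT hϑ hϑT in
/-- `(1 + p_0² + p_{N-1}²) e^{ϑH} ≤ (1 + 4/ε) e^{(ϑ+ε)H}` for `ε > 0` (`p_b² ≤ 2H ≤ (2/ε) e^{εH}`).
[folklore] -/
theorem one_add_sq_mul_exp_le {ε : ℝ} (hε : 0 < ε) (x : PhaseSpace N) :
    (1 + (x.2 ⟨0, hN⟩ ^ 2 + x.2 ⟨N - 1, Nat.sub_lt hN one_pos⟩ ^ 2)) *
        Real.exp (ϑ * (pinnedChain ω₂ lam β γ).hamiltonian N x) ≤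
      (1 + 4 / ε) * Real.exp ((ϑ + ε) * (pinnedChain ω₂ lam β γ).hamiltonian N x) := by
  set P := pinnedChain ω₂ lam β γ with hPdef
  have hP : P.IsConfining := pinnedChain_isConfining hω hl hβ hγ
  set Hx := P.hamiltonian N x with hHx
  have hH0 : 0 ≤ Hx := hP.hamiltonian_nonneg N x
  have hk := P.kinetic_le_hamiltonian_of_nonneg hP.U_nonneg hP.V_nonneg N x
  have h1 : x.2 ⟨0, hN⟩ ^ 2 / 2 ≤ ∑ i, x.2 i ^ 2 / 2 :=
    Finset.single_le_sum (f := fun i => x.2 i ^ 2 / 2) (fun i _ => by positivity) (Finset.mem_univ _)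
  have h2 : x.2 ⟨N - 1, Nat.sub_lt hN one_pos⟩ ^ 2 / 2 ≤ ∑ i, x.2 i ^ 2 / 2 :=
    Finset.single_le_sum (f := fun i => x.2 i ^ 2 / 2) (fun i _ => by positivity) (Finset.mem_univ _)
  have hS : x.2 ⟨0, hN⟩ ^ 2 + x.2 ⟨N - 1, Nat.sub_lt hN one_pos⟩ ^ 2 ≤ 4 * Hx := by rw [hHx]; linarith
  have hexp : ε * Hx + 1 ≤ Real.exp (ε * Hx) := Real.add_one_le_exp _
  have hHle : Hx ≤ Real.exp (ε * Hx) / ε := by rw [le_div_iff₀ hε]; nlinarith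
  have hE1 : 1 ≤ Real.exp (ε * Hx) := Real.one_le_exp (by positivity)
  have hsplit : Real.exp ((ϑ + ε) * Hx) = Real.exp (ϑ * Hx) * Real.exp (ε * Hx) := by
    rw [← Real.exp_add]; ring_nf
  rw [hsplit]
  have hV0 : 0 < Real.exp (ϑ * Hx) := Real.exp_pos _
  calc (1 + (x.2 ⟨0, hN⟩ ^ 2 + x.2 ⟨N - 1, Nat.sub_lt hN one_pos⟩ ^ 2)) * Real.exp (ϑ * Hx)
      ≤ (1 + 4 * Hx) * Real.exp (ϑ * Hx) := by gcongr
    _ ≤ (Real.exp (ε * Hx) + 4 * (Real.exp (ε * Hx) / ε)) * Real.exp (ϑ * Hx) := by gcongr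
    _ = (1 + 4 / ε) * (Real.exp (ϑ * Hx) * Real.exp (ε * Hx)) := by ring

/-- **(E) The Gibbs measure at `T` is an `O(δ)`-approximate steady state at `(T+δ/2, T-δ/2)` in the
`e^{ϑH}`-weighted dual norm** (`0 < ϑ < 1/T`, `t > 0`): there is `C ≥ 0` such that for every `δ`
with `|δ| < 2T` and `ϑ < 1/max(T+δ/2, T-δ/2)`, and every MEASURABLE `g` with `|g| ≤ e^{ϑH}`,
`|∫ (P_t^{(T+δ/2,T-δ/2)} g) dμ_T - ∫ g dμ_T| ≤ C |δ|`, `μ_T = gibbsMeasure N T`. Proof: the weighted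
Duhamel bound for the truncations `ρ_R = e^{-H/T}χ(H/R)`, whose defect is
`O(|δ| + 1/R)·(1 + p_0² + p_{N-1}²)e^{-H/T}` (`revGenerator_truncGibbs_defect_le`), and dominated
convergence `R → ∞`. [folklore] -/
theorem pinnedChain_gibbsMeasure_almost_invariant {t : ℝ≥0} (ht : 0 < t) :
    ∃ C : ℝ, 0 ≤ C ∧ ∀ δ : ℝ, |δ| < 2 * T → ϑ < 1 / max (T + δ / 2) (T - δ / 2) →
      ∀ g : PhaseSpace N → ℝ, Measurable g →
        (∀ y, |g y| ≤ Real.exp (ϑ * (pinnedChain ω₂ lam β γ).hamiltonian N y)) →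
        |∫ x, (∫ y, g y ∂((pinnedChain ω₂ lam β γ).transitionKernel N (T + δ / 2) (T - δ / 2) t x))
            ∂((pinnedChain ω₂ lam β γ).gibbsMeasure N T) -
          ∫ x, g x ∂((pinnedChain ω₂ lam β γ).gibbsMeasure N T)| ≤ C * |δ| := by
  set P := pinnedChain ω₂ lam β γ with hPdef
  have hP : P.IsConfining := pinnedChain_isConfining hω hl hβ hγ
  have hPγ : P.γ = γ := rfl
  have hU2 := pinnedChain_contDiff_U ω₂ lam β γ (n := 2)
  have hV2 := pinnedChain_contDiff_V ω₂ lam β γ (n := 2)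
  set Hm := P.hamiltonian N with hHm
  have hHc : Continuous Hm := pinnedChain_continuous_hamiltonian ω₂ lam β γ N
  have hH0 : ∀ y, 0 ≤ Hm y := fun y => hP.hamiltonian_nonneg N y
  -- the weights
  set Vr : PhaseSpace N → ℝ := fun y => Real.exp (ϑ * Hm y) with hVr
  have hVc : Continuous Vr := by rw [hVr]; fun_prop
  have hV0 : ∀ y, 0 < Vr y := fun y => Real.exp_pos _
  set ρ : PhaseSpace N → ℝ := P.gibbsDensity N T with hρdef
  have hρ : ρ = fun y => Real.exp (-Hm y / T) := rfl
  have hρc : Continuous ρ := by rw [hρ]; fun_prop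
  have hρ0 : ∀ y, 0 < ρ y := fun y => Real.exp_pos _
  have hρi : Integrable ρ := pinnedChain_integrable_gibbsDensity hω hl hβ γ N hT
  have hZ : 0 < ∫ x, ρ x := integral_exp_pos hρi
  have hρV : Integrable (fun x => Vr x * ρ x) := pinnedChain_integrable_exp_mul_gibbsDensity hω hl hβ γ N hT hϑT
  -- the majorant `(1 + 4/ε) e^{(ϑ+ε)H} ρ` of `(1 + S) e^{ϑH} ρ`
  set ε := (1 / T - ϑ) / 2 with hε
  have hε0 : 0 < ε := by rw [hε]; linarith
  have hϑε : ϑ + ε < 1 / T := by rw [hε]; linarith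
  have hmaj : Integrable (fun x => (1 + 4 / ε) * (Real.exp ((ϑ + ε) * Hm x) * ρ x)) :=
    (pinnedChain_integrable_exp_mul_gibbsDensity hω hl hβ γ N hT hϑε).const_mul _
  set M : ℝ := ∫ x, (1 + 4 / ε) * (Real.exp ((ϑ + ε) * Hm x) * ρ x) with hM
  have hM0 : 0 ≤ M := integral_nonneg fun x => by
    show (0:ℝ) ≤ (1 + 4 / ε) * (Real.exp ((ϑ + ε) * Hm x) * ρ x)
    exact mul_nonneg (by positivity) (mul_nonneg (Real.exp_pos _).le (hρ0 x).le)
  -- the defect constant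
  obtain ⟨κ, hκ0, hdef⟩ := revGenerator_truncGibbs_defect_le (P := P) hU2 hV2 hN (hPγ ▸ hγ) hT
  -- the constant
  set A : ℝ := t * Real.exp (2 * γ * t) * Real.exp (ϑ * γ * (2 * T) * t) with hA
  have hA0 : 0 ≤ A := by rw [hA]; positivity
  refine ⟨(∫ x, ρ x)⁻¹ * (A * (γ / (2 * T ^ 2)) * M),
    mul_nonneg (inv_nonneg.2 hZ.le) (mul_nonneg (mul_nonneg hA0 (by positivity)) hM0),
    fun δ hδ hϑmax g hgm hgb => ?_⟩
  have hTL : 0 < T + δ / 2 := by cases abs_lt.1 hδ; linarith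
  have hTR : 0 < T - δ / 2 := by cases abs_lt.1 hδ; linarith
  set K := P.transitionKernel N (T + δ / 2) (T - δ / 2) t with hKdef
  set Kg : PhaseSpace N → ℝ := fun x => ∫ y, g y ∂(K x) with hKg
  have hKgm : Measurable Kg := (hgm.stronglyMeasurable.integral_kernel (κ := K)).measurable
  have hCs : ϑ * γ * (T + δ / 2 + (T - δ / 2)) * t = ϑ * γ * (2 * T) * t := by ring
  have hKgb : ∀ x, |Kg x| ≤ Real.exp (ϑ * γ * (2 * T) * t) * Vr x := fun x => by
    have h := pinnedChain_abs_integral_transitionKernel_le hω hl hβ hγ hN hTL hTR hϑ hϑmax t x hgb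
    rwa [hCs] at h
  -- the truncations `ρ_n = e^{-H/T} χ(H/(n+1))` and their defects
  set ρR : ℕ → PhaseSpace N → ℝ := fun n y => Real.exp (-Hm y / T) * smoothCutoff (Hm y / (n + 1)) with hρR
  have hRpos : ∀ n : ℕ, (0:ℝ) < n + 1 := fun n => by positivity
  have hH2 : ContDiff ℝ 2 Hm := P.contDiff_hamiltonian hU2 hV2 N
  have hρR2 : ∀ n, ContDiff ℝ 2 (ρR n) := fun n => by
    have h1 : ContDiff ℝ 2 fun y => Real.exp (-Hm y / T) := (hH2.neg.div_const T).exp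
    have h2 : ContDiff ℝ 2 fun y => smoothCutoff (Hm y / (n + 1)) :=
      (contDiff_smoothCutoff (n := 2)).comp (hH2.div_const _)
    exact h1.mul h2
  have hρRsupp : ∀ n, HasCompactSupport (ρR n) := fun n => by
    refine HasCompactSupport.intro (hP.isCompact_setOf_hamiltonian_le N (2 * (n + 1))) fun y hy => ?_
    simp only [mem_setOf_eq, not_le] at hy
    have h2 : 2 ≤ Hm y / (n + 1) := by rw [le_div_iff₀ (hRpos n)]; linarith
    show Real.exp (-Hm y / T) * smoothCutoff (Hm y / (n + 1)) = 0
    rw [smoothCutoff_of_two_le h2, mul_zero]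
  have hρRle : ∀ n y, |ρR n y| ≤ ρ y := fun n y => by
    rw [abs_of_nonneg (mul_nonneg (Real.exp_pos _).le (smoothCutoff_nonneg _)), hρ]
    exact mul_le_of_le_one_right (Real.exp_pos _).le (smoothCutoff_le_one _)
  have hρRlim : ∀ y, Tendsto (fun n => ρR n y) atTop (𝓝 (ρ y)) := fun y => by
    refine tendsto_const_nhds.congr' ?_
    obtain ⟨n₀, hn₀⟩ := exists_nat_ge (Hm y)
    filter_upwards [eventually_ge_atTop n₀] with n hn
    have h1 : Hm y / (n + 1) ≤ 1 := by
      rw [div_le_one (hRpos n)]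
      have : (n₀ : ℝ) ≤ n := by exact_mod_cast hn
      linarith
    show ρ y = Real.exp (-Hm y / T) * smoothCutoff (Hm y / (n + 1))
    rw [smoothCutoff_of_le_one h1, mul_one, hρ]
  -- Duhamel + defect: `|∫ ρ_n (P_t g - g)| ≤ A (γ|δ|/(2T²) + κ/(n+1)) M`
  set L := sdeGenerator (fun z => -P.drift N z) (P.bathVecL N (T + δ / 2)) (P.bathVecR N (T - δ / 2)) with hL
  have hstep : ∀ n : ℕ, |∫ x, ρR n x * (Kg x - g x)| ≤ A * ((γ * |δ| / (2 * T ^ 2) + κ / (n + 1)) * M) := by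
    intro n
    have hdu := pinnedChain_abs_integral_mul_transitionKernel_sub_le hω hl hβ hγ hN hTL hTR hϑ hϑmax
      (hρR2 n) (hρRsupp n) hgm hgb ht
    rw [hCs] at hdu
    refine hdu.trans ?_
    rw [← hA]
    refine mul_le_mul_of_nonneg_left ?_ hA0
    -- pointwise defect bound, integrated
    have hpt : ∀ x, |L (ρR n) x + 2 * γ * ρR n x| * Vr x ≤
        (γ * |δ| / (2 * T ^ 2) + κ / (n + 1)) * ((1 + 4 / ε) * (Real.exp ((ϑ + ε) * Hm x) * ρ x)) := by
      intro x
      have hd := hdef δ hδ.le (n + 1) (by linarith [(n.cast_nonneg : (0:ℝ) ≤ n)]) x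
      rw [hPγ] at hd
      have hm := one_add_sq_mul_exp_le hω hl hβ hγ hN (ϑ := ϑ) hε0 x
      calc |L (ρR n) x + 2 * γ * ρR n x| * Vr x
          ≤ (γ * |δ| / (2 * T ^ 2) + κ / (n + 1)) *
              (1 + (x.2 ⟨0, hN⟩ ^ 2 + x.2 ⟨N - 1, Nat.sub_lt hN one_pos⟩ ^ 2)) *
              Real.exp (-Hm x / T) * Vr x := mul_le_mul_of_nonneg_right hd (hV0 x).le
        _ = (γ * |δ| / (2 * T ^ 2) + κ / (n + 1)) *
              (((1 + (x.2 ⟨0, hN⟩ ^ 2 + x.2 ⟨N - 1, Nat.sub_lt hN one_pos⟩ ^ 2)) * Vr x) * ρ x) := by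
              rw [hρ]; ring
        _ ≤ (γ * |δ| / (2 * T ^ 2) + κ / (n + 1)) *
              (((1 + 4 / ε) * Real.exp ((ϑ + ε) * Hm x)) * ρ x) := by
              refine mul_le_mul_of_nonneg_left (mul_le_mul_of_nonneg_right hm (hρ0 x).le) (by positivity)
        _ = _ := by ring
    have hint : Integrable (fun x => |L (ρR n) x + 2 * γ * ρR n x| * Vr x) := by
      have hYc : Continuous fun z => -P.drift N z := (hP.reversedDrift N).contDiff_drift.continuous
      have hEc : Continuous fun x => L (ρR n) x + 2 * γ * ρR n x :=
        (continuous_sdeGenerator _ _ hYc (hρR2 n)).add (continuous_const.mul (hρR2 n).continuous)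
      have hEsupp : HasCompactSupport fun x => L (ρR n) x + 2 * γ * ρR n x :=
        (hasCompactSupport_sdeGenerator _ _ (hρRsupp n)).add ((hρRsupp n).mul_left)
      exact (hEc.abs.mul hVc).integrable_of_hasCompactSupport (hEsupp.abs.mul_right)
    calc ∫ x, |L (ρR n) x + 2 * γ * ρR n x| * Vr x
        ≤ ∫ x, (γ * |δ| / (2 * T ^ 2) + κ / (n + 1)) * ((1 + 4 / ε) * (Real.exp ((ϑ + ε) * Hm x) * ρ x)) :=
          integral_mono hint (hmaj.const_mul _) hpt
      _ = (γ * |δ| / (2 * T ^ 2) + κ / (n + 1)) * M := by rw [integral_const_mul]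
  -- dominated convergence `n → ∞` on the left, `κ/(n+1) → 0` on the right
  have hgV : ∀ x, |Kg x - g x| ≤ (Real.exp (ϑ * γ * (2 * T) * t) + 1) * Vr x := fun x => by
    calc |Kg x - g x| ≤ |Kg x| + |g x| := abs_sub _ _
      _ ≤ Real.exp (ϑ * γ * (2 * T) * t) * Vr x + Vr x := add_le_add (hKgb x) (hgb x)
      _ = _ := by ring
  have hdom : Integrable (fun x => (Real.exp (ϑ * γ * (2 * T) * t) + 1) * (Vr x * ρ x)) := hρV.const_mul _
  have hlimL : Tendsto (fun n => ∫ x, ρR n x * (Kg x - g x)) atTop (𝓝 (∫ x, ρ x * (Kg x - g x))) := by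
    refine tendsto_integral_of_dominated_convergence (fun x => (Real.exp (ϑ * γ * (2 * T) * t) + 1) * (Vr x * ρ x))
      (fun n => (((hρR2 n).continuous.measurable).mul (hKgm.sub hgm)).aestronglyMeasurable) hdom
      (fun n => Eventually.of_forall fun x => ?_) (Eventually.of_forall fun x => ?_)
    · rw [Real.norm_eq_abs, abs_mul]
      calc |ρR n x| * |Kg x - g x| ≤ ρ x * ((Real.exp (ϑ * γ * (2 * T) * t) + 1) * Vr x) :=
            mul_le_mul (hρRle n x) (hgV x) (abs_nonneg _) (hρ0 x).le
        _ = _ := by ring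
    · exact (hρRlim x).mul_const _
  have hlimR : Tendsto (fun n : ℕ => A * ((γ * |δ| / (2 * T ^ 2) + κ / (n + 1)) * M)) atTop
      (𝓝 (A * ((γ * |δ| / (2 * T ^ 2) + 0) * M))) := by
    have hκn : Tendsto (fun n : ℕ => κ / ((n : ℝ) + 1)) atTop (𝓝 0) :=
      tendsto_const_nhds.div_atTop (tendsto_natCast_atTop_atTop.atTop_add tendsto_const_nhds)
    exact ((tendsto_const_nhds.add hκn).mul_const M).const_mul A
  rw [add_zero] at hlimR
  have hkey : |∫ x, ρ x * (Kg x - g x)| ≤ A * (γ * |δ| / (2 * T ^ 2) * M) :=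
    le_of_tendsto_of_tendsto' ((continuous_abs.tendsto _).comp hlimL) hlimR hstep
  -- back to the Gibbs measure
  have hVG : Integrable Vr (P.gibbsMeasure N T) :=
    pinnedChain_integrable_exp_mul_hamiltonian_gibbsMeasure hω hl hβ γ N hT hϑT
  have hKgG : Integrable Kg (P.gibbsMeasure N T) :=
    (hVG.const_mul _).mono' hKgm.aestronglyMeasurable (Eventually.of_forall fun x => by
      rw [Real.norm_eq_abs]; exact hKgb x)
  have hgG : Integrable g (P.gibbsMeasure N T) :=
    hVG.mono' hgm.aestronglyMeasurable (Eventually.of_forall fun x => by rw [Real.norm_eq_abs]; exact hgb x)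
  have hsub : (∫ x, Kg x ∂(P.gibbsMeasure N T)) - ∫ x, g x ∂(P.gibbsMeasure N T) =
      (∫ x, ρ x)⁻¹ * ∫ x, ρ x * (Kg x - g x) := by
    rw [← integral_sub hKgG hgG, P.integral_gibbsMeasure]
    congr 1
    exact integral_congr_ae (Eventually.of_forall fun x => by ring)
  rw [hsub, abs_mul, abs_of_pos (inv_pos.2 hZ)]
  calc (∫ x, ρ x)⁻¹ * |∫ x, ρ x * (Kg x - g x)| ≤ (∫ x, ρ x)⁻¹ * (A * (γ * |δ| / (2 * T ^ 2) * M)) :=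
        mul_le_mul_of_nonneg_left hkey (inv_pos.2 hZ).le
    _ = (∫ x, ρ x)⁻¹ * (A * (γ / (2 * T ^ 2)) * M) * |δ| := by ring

end AlmostInvariant

/-- Registered helper sub-goal `helper_nessGibbsAlmostInvariant` of stmt-AtomisticToContinuum-11976
(= `pinnedChain_gibbsMeasure_almost_invariant`, fully quantified, notation-free one-line form). -/
theorem helper_nessGibbsAlmostInvariant : ∀ (ω₂ lam β γ : ℝ), 0 < ω₂ → 0 ≤ lam → 0 ≤ β → 0 ≤ γ → ∀ (N : ℕ), 0 < N → ∀ (T : ℝ), 0 < T → ∀ (ϑ : ℝ), 0 < ϑ → ϑ < 1 / T → ∀ (t : NNReal), 0 < t → ∃ C : ℝ, 0 ≤ C ∧ ∀ δ : ℝ, |δ| < 2 * T → ϑ < 1 / max (T + δ / 2) (T - δ / 2) → ∀ g : Literature.MathematicalPhysics.KineticTheory.HeatConduction.PhaseSpace N → ℝ, Measurable g → (∀ y, |g y| ≤ Real.exp (ϑ * (Literature.MathematicalPhysics.KineticTheory.HeatConduction.pinnedChain ω₂ lam β γ).hamiltonian N y)) → |MeasureTheory.integral ((Literature.MathematicalPhysics.KineticTheory.HeatConduction.pinnedChain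 ω₂ lam β γ).gibbsMeasure N T) (fun x => MeasureTheory.integral ((Literature.MathematicalPhysics.KineticTheory.HeatConduction.pinnedChain ω₂ lam β γ).transitionKernel N (T + δ / 2) (T - δ / 2) t x) (fun y => g y)) - MeasureTheory.integral ((Literature.MathematicalPhysics.KineticTheory.HeatConduction.pinnedChain ω₂ lam β γ).gibbsMeasure N T) (fun x => g x)| ≤ C * |δ| :=
  fun _ _ _ _ hω hl hβ hγ _ hN _ hT _ hϑ hϑT _ ht =>
    pinnedChain_gibbsMeasure_almost_invariant hω hl hβ hγ hN hT hϑ hϑT ht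

end Summit.AtomisticToContinuum.FouriersLaw.Theorems.FixedLengthNoiseContinuity

end
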